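import Mathlib
import Summits.MatrixMultiplication.Statement
import Summits.MatrixMultiplication.MatrixMultiplication.Theorems.GraphEquationsTowerFrame

/-!
# Graph equations — row transport for the tower step (M23d)

Linear-algebra bookkeeping for the passage from stage `κ` to stage `κ ⊕ ((Fin n × Fin n) ⊕ κ)` of the
pivot-normalised identity tower (NODE-g36 §3):

* `padRow` — an old fibre vector padded by `0` on the fresh block (the row of an embedded polynomial,
  `padRow_towerRow`), `projNew` — the fresh-block part of a new fibre vector (the row of a stage
  derivative projects to the old row, `projNew_towerRow_stageDer`);
* `padNew_single_mem_of_mem_span_projNew` — if `e_x` is in the span of the fresh-block parts of vectors of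
  a subspace `V` containing the old standard vectors, then the fresh standard vector `e_{λ_x}` is in
  `V` (how the kernel-variable functionals enter the row space);
* `single_mem_span_of_proj_comp_eq_zero` — the FREE TEST through the linear kernel section `Ψ` of
  `exists_kernelSection_linear`: if the `y`-coordinate of `Ψ` vanishes identically then `e_y` is in
  the row space;
* fold/word transport helpers.
-/

set_option linter.dupNamespace false

noncomputable section

open scoped BigOperators

namespace Summit.MatrixMultiplication.MatrixMultiplication.Theorems.GraphEquations

open MvPolynomial
open Literature.Computability.AlgebraicComplexity

variable {n : ℕ}

section StepRows

variable {K : Type*} [Field K] [Algebra ℂ K] [Algebra (MvPolynomial (MatMulVars n) ℂ) K]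
variable {κ : Type} [Fintype κ] [DecidableEq κ]

/-! ### Padding and projecting fibre vectors -/

/-- An old fibre vector padded by zero on the fresh block. -/
def padRow (n : ℕ) (κ : Type) (K : Type*) [Field K] :
    ((Fin n × Fin n) ⊕ κ → K) →ₗ[K] ((Fin n × Fin n) ⊕ (κ ⊕ ((Fin n × Fin n) ⊕ κ)) → K) where
  toFun r := Sum.elim (fun q => r (Sum.inl q)) (Sum.elim (fun i => r (Sum.inr i)) fun _ => 0)
  map_add' r r' := by funext y; rcases y with q | i | x <;> simp
  map_smul' c r := by funext y; rcases y with q | i | x <;> simp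

omit [Fintype κ] [DecidableEq κ] in
/-- The row of an embedded polynomial is the padded old row. -/
theorem padRow_towerRow (lam : κ → K) (μ : (Fin n × Fin n) ⊕ κ → K)
    (g : MvPolynomial (GraphVars n ⊕ κ) ℂ) :
    padRow n κ K (towerRow lam g) = towerRow (Sum.elim lam μ) (rename (Sum.map id Sum.inl) g) :=
  (towerRow_rename_ι lam μ g).symm

omit [Algebra ℂ K] [Algebra (MvPolynomial (MatMulVars n) ℂ) K] [Fintype κ] in
/-- Padding the standard vector of `c_q`. -/
theorem padRow_single_inl (q : Fin n × Fin n) :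
    padRow n κ K (Pi.single (Sum.inl q) 1) = Pi.single (Sum.inl q) 1 := by
  funext y
  rcases y with q' | i | x
  · by_cases h : q' = q
    · subst h; simp [padRow]
    · simp [padRow, h]
  · simp [padRow]
  · simp [padRow]

omit [Algebra ℂ K] [Algebra (MvPolynomial (MatMulVars n) ℂ) K] [Fintype κ] in
/-- Padding the standard vector of an old kernel variable. -/
theorem padRow_single_inr (i : κ) :
    padRow n κ K (Pi.single (Sum.inr i) 1) = Pi.single (Sum.inr (Sum.inl i)) 1 := by
  funext y
  rcases y with q | i' | x
  · simp [padRow]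
  · by_cases h : i' = i
    · subst h; simp [padRow]
    · simp [padRow, h]
  · simp [padRow]

/-- The fresh-block part of a new fibre vector. -/
def projNew (n : ℕ) (κ : Type) (K : Type*) [Field K] :
    ((Fin n × Fin n) ⊕ (κ ⊕ ((Fin n × Fin n) ⊕ κ)) → K) →ₗ[K] ((Fin n × Fin n) ⊕ κ → K) where
  toFun r := fun x => r (Sum.inr (Sum.inr x))
  map_add' _ _ := rfl
  map_smul' _ _ := rfl

omit [Algebra ℂ K] [Algebra (MvPolynomial (MatMulVars n) ℂ) K] [Fintype κ] [DecidableEq κ] in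
/-- Unfolding of `projNew`. -/
theorem projNew_apply (r : (Fin n × Fin n) ⊕ (κ ⊕ ((Fin n × Fin n) ⊕ κ)) → K) (x) :
    projNew n κ K r x = r (Sum.inr (Sum.inr x)) := rfl

/-- The row of a stage derivative projects to the old row. -/
theorem projNew_towerRow_stageDer (lam : κ → K) (μ : (Fin n × Fin n) ⊕ κ → K)
    (g : MvPolynomial (GraphVars n ⊕ κ) ℂ) :
    projNew n κ K (towerRow (Sum.elim lam μ) (stageDer n κ (rename (Sum.map id Sum.inl) g))) =
      towerRow lam g :=
  funext fun x => towerRow_stageDer_rename_new lam μ g x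

omit [Algebra ℂ K] [Algebra (MvPolynomial (MatMulVars n) ℂ) K] [Fintype κ] in
/-- A fresh standard vector projects to the old standard vector. -/
theorem projNew_single_new (x : (Fin n × Fin n) ⊕ κ) :
    projNew n κ K (Pi.single (Sum.inr (Sum.inr x)) 1) = Pi.single x 1 := by
  funext x'
  rw [projNew_apply]
  by_cases h : x' = x
  · subst h; simp
  · rw [Pi.single_eq_of_ne (by simpa using h), Pi.single_eq_of_ne h]

omit [Algebra ℂ K] [Algebra (MvPolynomial (MatMulVars n) ℂ) K] [Fintype κ] [DecidableEq κ] in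
/-- The indicator of `y` is the standard vector `e_y`. -/
theorem ite_eq_single {Y : Type*} [DecidableEq Y] (y : Y) :
    (fun j => if y = j then (1 : K) else 0) = Pi.single y 1 := by
  funext j; rw [Pi.single_apply]; simp only [eq_comm]

omit [Algebra ℂ K] [Algebra (MvPolynomial (MatMulVars n) ℂ) K] in
/-- A vector with zero fresh block lies in any subspace containing the old standard vectors. -/
theorem mem_of_projNew_eq_zero (V : Submodule K ((Fin n × Fin n) ⊕ (κ ⊕ ((Fin n × Fin n) ⊕ κ)) → K))
    (hq : ∀ q, (Pi.single (Sum.inl q) 1 : _ → K) ∈ V)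
    (hi : ∀ i : κ, (Pi.single (Sum.inr (Sum.inl i)) 1 : _ → K) ∈ V)
    {r : (Fin n × Fin n) ⊕ (κ ⊕ ((Fin n × Fin n) ⊕ κ)) → K} (hr : projNew n κ K r = 0) : r ∈ V := by
  classical
  rw [pi_eq_sum_univ r]
  refine V.sum_mem fun y _ => ?_
  rw [ite_eq_single]
  rcases y with q | i | x
  · exact V.smul_mem _ (hq q)
  · exact V.smul_mem _ (hi i)
  · have : r (Sum.inr (Sum.inr x)) = 0 := by rw [← projNew_apply (K := K) r x, hr]; rfl
    rw [this, zero_smul]; exact V.zero_mem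

omit [Algebra ℂ K] [Algebra (MvPolynomial (MatMulVars n) ℂ) K] in
/-- **Lift lemma.** If `v` lies in the span of the fresh-block parts of vectors of a set `A ⊆ V`,
`V` a subspace containing the old standard vectors, then `v` padded by zero on the OLD blocks lies in
`V`. -/
theorem padNew_mem_of_mem_span_projNew
    (V : Submodule K ((Fin n × Fin n) ⊕ (κ ⊕ ((Fin n × Fin n) ⊕ κ)) → K))
    (hq : ∀ q, (Pi.single (Sum.inl q) 1 : _ → K) ∈ V)
    (hi : ∀ i : κ, (Pi.single (Sum.inr (Sum.inl i)) 1 : _ → K) ∈ V)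
    {A : Set ((Fin n × Fin n) ⊕ (κ ⊕ ((Fin n × Fin n) ⊕ κ)) → K)} (hA : A ⊆ V)
    {v : (Fin n × Fin n) ⊕ κ → K} (hv : v ∈ Submodule.span K (projNew n κ K '' A)) :
    (Sum.elim (fun _ => (0 : K)) (Sum.elim (fun _ => (0 : K)) v) :
      (Fin n × Fin n) ⊕ (κ ⊕ ((Fin n × Fin n) ⊕ κ)) → K) ∈ V := by
  rw [Submodule.span_image] at hv
  obtain ⟨a, ha, hav⟩ := Submodule.mem_map.mp hv
  have haV : a ∈ V := (Submodule.span_le.mpr hA) ha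
  set p : (Fin n × Fin n) ⊕ (κ ⊕ ((Fin n × Fin n) ⊕ κ)) → K :=
    Sum.elim (fun _ => (0 : K)) (Sum.elim (fun _ => (0 : K)) v) with hp
  have h0 : projNew n κ K (a - p) = 0 := by
    rw [map_sub, hav]; funext x; rw [Pi.sub_apply, projNew_apply, hp]; simp
  have h1 := mem_of_projNew_eq_zero V hq hi h0
  have : p = a - (a - p) := by abel
  rw [this]
  exact V.sub_mem haV h1

omit [Algebra ℂ K] [Algebra (MvPolynomial (MatMulVars n) ℂ) K] in
/-- **Fresh standard vectors.** With `V`, `A` as in the lift lemma: if the fresh-block parts of `A`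
span `e_x`, then `e_{λ_x} ∈ V`. -/
theorem single_new_mem_of_mem_span_projNew
    (V : Submodule K ((Fin n × Fin n) ⊕ (κ ⊕ ((Fin n × Fin n) ⊕ κ)) → K))
    (hq : ∀ q, (Pi.single (Sum.inl q) 1 : _ → K) ∈ V)
    (hi : ∀ i : κ, (Pi.single (Sum.inr (Sum.inl i)) 1 : _ → K) ∈ V)
    {A : Set ((Fin n × Fin n) ⊕ (κ ⊕ ((Fin n × Fin n) ⊕ κ)) → K)} (hA : A ⊆ V)
    {x : (Fin n × Fin n) ⊕ κ} (hx : (Pi.single x 1 : _ → K) ∈ Submodule.span K (projNew n κ K '' A)) :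
    (Pi.single (Sum.inr (Sum.inr x)) 1 : _ → K) ∈ V := by
  have h := padNew_mem_of_mem_span_projNew V hq hi hA hx
  have : (Pi.single (Sum.inr (Sum.inr x)) 1 : (Fin n × Fin n) ⊕ (κ ⊕ ((Fin n × Fin n) ⊕ κ)) → K) =
      Sum.elim (fun _ => (0 : K)) (Sum.elim (fun _ => (0 : K)) (Pi.single x 1)) := by
    funext y
    rcases y with q | i | x'
    · simp
    · simp
    · by_cases h' : x' = x
      · subst h'; simp
      · rw [Pi.single_eq_of_ne (by simpa using h'), Sum.elim_inr, Sum.elim_inr, Pi.single_eq_of_ne h']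
  rw [this]; exact h

/-! ### The free test through the kernel section -/

omit [Algebra ℂ K] [Algebra (MvPolynomial (MatMulVars n) ℂ) K] [Fintype κ] [DecidableEq κ] in
/-- **Free test.** For a linear kernel section `Ψ` of `Rows` pinned on `S` (as supplied by
`exists_kernelSection_linear`): if the `y`-coordinate of `Ψ` vanishes identically, then `e_y` lies in
the span of the rows. -/
theorem single_mem_span_of_proj_comp_eq_zero {Y : Type*} [Fintype Y] [DecidableEq Y]
    {Rows : Set (Y → K)} {S : Finset Y} {Ψ : (Y → K) →ₗ[K] (Y → K)}
    (hann : ∀ w, ∀ r ∈ Rows, ∑ x, r x * Ψ w x = 0) (hS : ∀ w, ∀ x ∈ S, Ψ w x = w x)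
    (huniq : ∀ δ : Y → K, (∀ r ∈ Rows, ∑ x, r x * δ x = 0) → (∀ x ∈ S, δ x = 0) → δ = 0)
    {y : Y} (hy : (LinearMap.proj y).comp Ψ = 0) :
    (Pi.single y 1 : Y → K) ∈ Submodule.span K Rows := by
  by_contra h
  obtain ⟨δ, hδ, hδy⟩ := exists_dotAnnihilator_apply_ne_zero h
  have hfix : Ψ δ = δ := by
    have := huniq (Ψ δ - δ) (fun r hr => by
      simp only [Pi.sub_apply, mul_sub, Finset.sum_sub_distrib, hann δ r hr, hδ r hr, sub_zero])
      (fun x hx => by rw [Pi.sub_apply, hS δ x hx, sub_self])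
    exact sub_eq_zero.mp this
  apply hδy
  have := LinearMap.congr_fun hy δ
  rw [LinearMap.comp_apply, LinearMap.proj_apply, hfix, LinearMap.zero_apply] at this
  exact this

omit [Algebra ℂ K] [Algebra (MvPolynomial (MatMulVars n) ℂ) K] [Fintype κ] [DecidableEq κ] in
/-- The `y`-coordinate of a kernel section that does not vanish identically is non-zero SOMEWHERE
(used with `exists_complex_point_forall_ne_zero`); conversely, at a point where it is non-zero the
section has non-zero `y`-coordinate (tautology recorded for the step). -/
theorem proj_comp_apply {Y : Type*} (Ψ : (Y → K) →ₗ[K] (Y → K)) (y : Y) (w : Y → K) :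
    ((LinearMap.proj y).comp Ψ) w = Ψ w y := rfl

/-! ### Word transport -/

omit [Fintype κ] [DecidableEq κ] in
/-- The embedded base polynomial of the next ring is the transport of the old one. -/
theorem rename_ι_rename_inl (t : MvPolynomial (GraphVars n) ℂ) :
    rename (Sum.map id Sum.inl) (rename Sum.inl t : MvPolynomial (GraphVars n ⊕ κ) ℂ) =
      (rename Sum.inl t : MvPolynomial (GraphVars n ⊕ (κ ⊕ ((Fin n × Fin n) ⊕ κ))) ℂ) := by
  rw [rename_rename]; rfl

omit [Fintype κ] [DecidableEq κ] in
/-- Transported words of an embedded base polynomial. -/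
theorem foldl_map_liftDer_rename_inl
    (w : List (Derivation ℂ (MvPolynomial (GraphVars n ⊕ κ) ℂ) (MvPolynomial (GraphVars n ⊕ κ) ℂ)))
    (t : MvPolynomial (GraphVars n) ℂ) :
    (w.map liftDer).foldl (fun acc D => D acc)
        (rename Sum.inl t : MvPolynomial (GraphVars n ⊕ (κ ⊕ ((Fin n × Fin n) ⊕ κ))) ℂ) =
      rename (Sum.map id Sum.inl) (w.foldl (fun acc D => D acc)
        (rename Sum.inl t : MvPolynomial (GraphVars n ⊕ κ) ℂ)) := by
  rw [← foldl_liftDer_rename, rename_ι_rename_inl]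

omit [Fintype κ] [DecidableEq κ] in
/-- A word extended by one more derivation. -/
theorem foldl_append_singleton {A : Type*} [CommRing A] [Algebra ℂ A] (w : List (Derivation ℂ A A))
    (D : Derivation ℂ A A) (g : A) :
    (w ++ [D]).foldl (fun acc D' => D' acc) g = D (w.foldl (fun acc D' => D' acc) g) := by
  rw [List.foldl_append, List.foldl_cons, List.foldl_nil]

end StepRows

end Summit.MatrixMultiplication.MatrixMultiplication.Theorems.GraphEquations

end
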